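import Mathlib.Analysis.InnerProductSpace.PiL2
import Mathlib.Analysis.Real.Sqrt
import Literature.Geometry.DiscreteGeometry.KissingPatterns
import Literature.Barriers.AtomisticToContinuum.FlexibleKissingArrangements
import Summits.AtomisticToContinuum.Crystallization.Theses.TwoCentreKissingKernel
import HarnessLib

/-!
# `RobustTangencyBound` — transfer of soft contacts under `1/10`-closeness (helper file)

Helper lemmas for item `stmt-AtomisticToContinuum-12082` (`RobustTangencyBound`, route
`TwoCentreKissingKernel`, sub-problem Crystallization).

If a shell `T` is `δ`-close after a linear isometry to a pattern `P` (`ShellCloseTo δ T P`: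
a bijection `T ≃ A(P)` moving each point by `≤ δ`), then every pair of points of `T` at distance
`≤ 1 + η` is matched to a pair of points of `P` at distance `≤ 1 + η + 2δ`.  For the FCC and HCP
kissing patterns all distances other than the `24` contacts (distance `1`) are `≥ √2`, so for
`1 + η + 2δ < √2` (e.g. `η ≤ 10⁻³`, `δ = 1/10`: `1.201 < 1.414`) soft contacts of `T` are carried
INTO pattern contacts, injectively.  Consequences proved here:

* `card_softNbrs_le_of_shellCloseTo`: each point of `T` has at most as many soft neighbours in
  `T` as a pattern point has pattern points within `√2` — for FCC/HCP, at most `4`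
  (`card_near_fcc_le_four`, `card_near_hcp_le_four`, integer arithmetic by `decide`);
* `not_shellCloseTo_fcc_of_five_softNbrs` / `…_hcp_…`: a shell with a point having `≥ 5` soft
  neighbours is NOT `1/10`-close to either pattern (the shape of any exotic counterexample, and
  the necessary `4`-regularity of the soft contact graph in the positive direction).
-/

noncomputable section

namespace Summit.AtomisticToContinuum.Crystallization.Theorems

open Literature.Geometry.DiscreteGeometry Finset

/-! ### Near pairs in scaled integer patterns -/

/-- In the scaled pattern `{v/√N}`, two points are at distance `< √2` iff the integer vectors
differ by squared norm `< 2N`. -/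
theorem dist_scaled_lt_sqrt_two_iff {N : ℕ} (hN : N ≠ 0) (v w : Fin 3 → ℤ) :
    dist ((Real.sqrt N)⁻¹ • intVec v : EuclideanSpace ℝ (Fin 3)) ((Real.sqrt N)⁻¹ • intVec w)
        < Real.sqrt 2 ↔
      sqNormInt (v - w) < 2 * (N : ℤ) := by
  rw [Literature.Barriers.AtomisticToContinuum.dist_scaled]
  have hNpos : (0 : ℝ) < (N : ℝ) := by exact_mod_cast Nat.pos_of_ne_zero hN
  have hsN : (0 : ℝ) < Real.sqrt N := Real.sqrt_pos.2 hNpos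
  have hq : (0 : ℝ) ≤ (sqNormInt (v - w) : ℝ) := by
    have : (0 : ℤ) ≤ sqNormInt (v - w) := by unfold sqNormInt; positivity
    exact_mod_cast this
  rw [inv_mul_lt_iff₀ hsN, ← Real.sqrt_mul (Nat.cast_nonneg N),
    Real.sqrt_lt_sqrt_iff hq, mul_comm]
  constructor
  · intro h; exact_mod_cast h
  · intro h; exact_mod_cast h

/-- Counting near pairs of a scaled integer pattern in integers: if every `v ∈ S` has at most
`k` other vectors of `S` within squared norm `< 2N`, then every point of `{v/√N : v ∈ S}` has at
most `k` other points of the pattern within distance `< √2`. -/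
theorem card_near_scaledPattern_le (S : Finset (Fin 3 → ℤ)) {N : ℕ} (hN : N ≠ 0) {k : ℕ}
    (hS : ∀ v ∈ S, (S.filter fun w => w ≠ v ∧ sqNormInt (v - w) < 2 * (N : ℤ)).card ≤ k) :
    ∀ p ∈ scaledPattern S N,
      ((scaledPattern S N).filter fun q => q ≠ p ∧ dist p q < Real.sqrt 2).card ≤ k := by
  classical
  intro p hp
  obtain ⟨v, hv, rfl⟩ := Finset.mem_image.1 hp
  have hinj := scaledPattern_map_injective hN
  unfold scaledPattern
  rw [Finset.filter_image, Finset.card_image_of_injective _ hinj]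
  refine le_trans (Finset.card_le_card ?_) (hS v hv)
  intro w hw
  rw [Finset.mem_filter] at hw ⊢
  refine ⟨hw.1, fun h => hw.2.1 (by rw [h]), ?_⟩
  exact (dist_scaled_lt_sqrt_two_iff hN v w).1 hw.2.2

/-- In the FCC integer model every vector has at most `4` others within squared distance `< 4`
(in fact exactly the `4` contacts at squared distance `2`). -/
theorem card_near_fccInt_le_four :
    ∀ v ∈ fccInt,
      (fccInt.filter fun w => w ≠ v ∧ sqNormInt (v - w) < 2 * ((2 : ℕ) : ℤ)).card ≤ 4 := by
  decide

/-- In the HCP integer model every vector has at most `4` others within squared distance `< 36`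
(exactly the `4` contacts at squared distance `18`). -/
theorem card_near_hcpInt_le_four :
    ∀ v ∈ hcpInt,
      (hcpInt.filter fun w => w ≠ v ∧ sqNormInt (v - w) < 2 * ((18 : ℕ) : ℤ)).card ≤ 4 := by
  decide

/-- **Every point of the FCC pattern has at most `4` other pattern points within distance `√2`**
(its four contacts; all other distances are `≥ √2`). -/
theorem card_near_fcc_le_four :
    ∀ p ∈ fccKissingPattern,
      (fccKissingPattern.filter fun q => q ≠ p ∧ dist p q < Real.sqrt 2).card ≤ 4 :=
  card_near_scaledPattern_le fccInt two_ne_zero card_near_fccInt_le_four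

/-- **Every point of the HCP pattern has at most `4` other pattern points within distance `√2`.** -/
theorem card_near_hcp_le_four :
    ∀ p ∈ hcpKissingPattern,
      (hcpKissingPattern.filter fun q => q ≠ p ∧ dist p q < Real.sqrt 2).card ≤ 4 :=
  card_near_scaledPattern_le hcpInt (by norm_num) card_near_hcpInt_le_four

/-! ### Transfer of soft contacts under `ShellCloseTo` -/

/-- Near-pair counts are invariant under a linear isometry: the points of `A(P)` within `√2` of
`A p` are the images of the points of `P` within `√2` of `p`. -/
theorem card_near_image_linearIsometry
    (A : EuclideanSpace ℝ (Fin 3) →ₗᵢ[ℝ] EuclideanSpace ℝ (Fin 3))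
    (P : Finset (EuclideanSpace ℝ (Fin 3))) (p : EuclideanSpace ℝ (Fin 3)) :
    ((P.image A).filter fun q => q ≠ A p ∧ dist (A p) q < Real.sqrt 2).card =
      (P.filter fun q => q ≠ p ∧ dist p q < Real.sqrt 2).card := by
  classical
  rw [Finset.filter_image, Finset.card_image_of_injective _ A.injective]
  congr 1
  refine Finset.filter_congr fun q _ => ?_
  rw [A.injective.ne_iff, A.isometry.dist_eq]

/-- **Transfer lemma.** If `T` is `δ`-close after a linear isometry to `P`, every point of `P`
has at most `k` other pattern points within distance `√2`, and `1 + η + 2δ < √2`, then every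
point of `T` has at most `k` other points of `T` within distance `1 + η`: the matching sends
the soft neighbours of `t` injectively to pattern points within `δ + (1 + η) + δ < √2` of the
partner of `t`. -/
theorem card_softNbrs_le_of_shellCloseTo {η δ : ℝ} {T P : Finset (EuclideanSpace ℝ (Fin 3))} {k : ℕ}
    (hgap : 1 + η + 2 * δ < Real.sqrt 2)
    (hP : ∀ p ∈ P, (P.filter fun q => q ≠ p ∧ dist p q < Real.sqrt 2).card ≤ k)
    (h : ShellCloseTo δ T P) :
    ∀ t ∈ T, (T.filter fun t' => t' ≠ t ∧ dist t t' ≤ 1 + η).card ≤ k := by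
  classical
  obtain ⟨A, e, he⟩ := h
  intro t ht
  -- the partner of `t` and its preimage in `P`
  have het : ((e ⟨t, ht⟩ : ↥(P.image A)) : EuclideanSpace ℝ (Fin 3)) ∈ P.image A := (e ⟨t, ht⟩).2
  obtain ⟨p, hp, hpe⟩ := Finset.mem_image.1 het
  -- the matching as a map on `EuclideanSpace ℝ (Fin 3)`
  let f : EuclideanSpace ℝ (Fin 3) → EuclideanSpace ℝ (Fin 3) := fun x =>
    if hx : x ∈ T then ((e ⟨x, hx⟩ : ↥(P.image A)) : EuclideanSpace ℝ (Fin 3)) else 0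
  have hf : ∀ x (hx : x ∈ T), f x = ((e ⟨x, hx⟩ : ↥(P.image A)) : EuclideanSpace ℝ (Fin 3)) :=
    fun x hx => by
    simp only [f, dif_pos hx]
  have hmaps : Set.MapsTo f ↑(T.filter fun t' => t' ≠ t ∧ dist t t' ≤ 1 + η)
      ↑((P.image A).filter fun q => q ≠ A p ∧ dist (A p) q < Real.sqrt 2) := by
    intro x hx
    rw [Finset.coe_filter, Set.mem_setOf_eq] at hx
    obtain ⟨hxT, hxt, hdx⟩ := hx
    rw [Finset.coe_filter, Set.mem_setOf_eq, hf x hxT, hpe]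
    refine ⟨(e ⟨x, hxT⟩).2, ?_, ?_⟩
    · intro hxe
      have : e ⟨x, hxT⟩ = e ⟨t, ht⟩ := Subtype.ext hxe
      rw [e.injective.eq_iff, Subtype.mk.injEq] at this
      exact hxt this
    · have h1 : dist t ((e ⟨t, ht⟩ : ↥(P.image A)) : EuclideanSpace ℝ (Fin 3)) ≤ δ := he ⟨t, ht⟩
      have h2 : dist x ((e ⟨x, hxT⟩ : ↥(P.image A)) : EuclideanSpace ℝ (Fin 3)) ≤ δ :=
        he ⟨x, hxT⟩
      calc dist ((e ⟨t, ht⟩ : ↥(P.image A)) : EuclideanSpace ℝ (Fin 3))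
            ((e ⟨x, hxT⟩ : ↥(P.image A)) : EuclideanSpace ℝ (Fin 3))
          ≤ dist ((e ⟨t, ht⟩ : ↥(P.image A)) : EuclideanSpace ℝ (Fin 3)) t + dist t x
              + dist x ((e ⟨x, hxT⟩ : ↥(P.image A)) : EuclideanSpace ℝ (Fin 3)) :=
            dist_triangle4 _ _ _ _
        _ ≤ δ + (1 + η) + δ := by rw [dist_comm _ t]; gcongr
        _ = 1 + η + 2 * δ := by ring
        _ < Real.sqrt 2 := hgap
  have hinj : Set.InjOn f ↑(T.filter fun t' => t' ≠ t ∧ dist t t' ≤ 1 + η) := by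
    intro x hx y hy hxy
    rw [Finset.coe_filter, Set.mem_setOf_eq] at hx hy
    rw [hf x hx.1, hf y hy.1] at hxy
    have : e ⟨x, hx.1⟩ = e ⟨y, hy.1⟩ := Subtype.ext hxy
    rw [e.injective.eq_iff, Subtype.mk.injEq] at this
    exact this
  calc (T.filter fun t' => t' ≠ t ∧ dist t t' ≤ 1 + η).card
      ≤ ((P.image A).filter fun q => q ≠ A p ∧ dist (A p) q < Real.sqrt 2).card :=
        Finset.card_le_card_of_injOn f hmaps hinj
    _ = (P.filter fun q => q ≠ p ∧ dist p q < Real.sqrt 2).card :=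
        card_near_image_linearIsometry A P p
    _ ≤ k := hP p hp

/-- The numerical gap used by the route: for `η ≤ 10⁻³` and `δ = 1/10`, `1 + η + 2δ < √2`
(`1.201² = 1.4424… < 2`). -/
theorem one_add_eta_add_two_tenth_lt_sqrt_two {η : ℝ} (hη : η ≤ 1 / 1000) :
    1 + η + 2 * (1 / 10) < Real.sqrt 2 := by
  have h : (1201 / 1000 : ℝ) < Real.sqrt 2 := by
    rw [Real.lt_sqrt (by norm_num)]; norm_num
  linarith

/-- **A shell with a five-fold soft-coordinated point is not `1/10`-close to the FCC pattern.**
If `η ≤ 10⁻³` and some `t ∈ T` has at least `5` other points of `T` within `1 + η`, then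
`¬ ShellCloseTo (1/10) T fccKissingPattern`. -/
theorem not_shellCloseTo_fcc_of_five_softNbrs {η : ℝ} (hη : η ≤ 1 / 1000)
    {T : Finset (EuclideanSpace ℝ (Fin 3))} {t : EuclideanSpace ℝ (Fin 3)} (ht : t ∈ T)
    (h5 : 5 ≤ (T.filter fun t' => t' ≠ t ∧ dist t t' ≤ 1 + η).card) :
    ¬ ShellCloseTo (1 / 10) T fccKissingPattern := fun h =>
  absurd (card_softNbrs_le_of_shellCloseTo (one_add_eta_add_two_tenth_lt_sqrt_two hη)
    card_near_fcc_le_four h t ht) (by omega)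

/-- **A shell with a five-fold soft-coordinated point is not `1/10`-close to the HCP pattern.** -/
theorem not_shellCloseTo_hcp_of_five_softNbrs {η : ℝ} (hη : η ≤ 1 / 1000)
    {T : Finset (EuclideanSpace ℝ (Fin 3))} {t : EuclideanSpace ℝ (Fin 3)} (ht : t ∈ T)
    (h5 : 5 ≤ (T.filter fun t' => t' ≠ t ∧ dist t t' ≤ 1 + η).card) :
    ¬ ShellCloseTo (1 / 10) T hcpKissingPattern := fun h =>
  absurd (card_softNbrs_le_of_shellCloseTo (one_add_eta_add_two_tenth_lt_sqrt_two hη)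
    card_near_hcp_le_four h t ht) (by omega)

/-- **Necessary condition extracted from `RobustTangencyBound`'s conclusion.** Under the
conclusion of the item (closeness to FCC or HCP at `1/10`) with `η ≤ 10⁻³`, every point of the
shell has at most four soft neighbours (points of `T` within `1 + η`); with `≥ 48` ordered soft
pairs on twelve points the soft contact graph is therefore `4`-regular. -/
theorem card_softNbrs_le_four_of_shellCloseTo_fcc_or_hcp {η : ℝ} (hη : η ≤ 1 / 1000)
    {T : Finset (EuclideanSpace ℝ (Fin 3))}
    (h : ShellCloseTo (1 / 10) T fccKissingPattern ∨ ShellCloseTo (1 / 10) T hcpKissingPattern) :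
    ∀ t ∈ T, (T.filter fun t' => t' ≠ t ∧ dist t t' ≤ 1 + η).card ≤ 4 := by
  rcases h with h | h
  · exact card_softNbrs_le_of_shellCloseTo (one_add_eta_add_two_tenth_lt_sqrt_two hη)
      card_near_fcc_le_four h
  · exact card_softNbrs_le_of_shellCloseTo (one_add_eta_add_two_tenth_lt_sqrt_two hη)
      card_near_hcp_le_four h

end Summit.AtomisticToContinuum.Crystallization.Theorems

end
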